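import Mathlib
import Literature.Computability.AlgebraicComplexity.GroupTheoreticMatMul
import Literature.Combinatorics.Additive.Kneser
import Summits.MatrixMultiplication.OmegaCensus.STPPDisjointPacking
import Summits.MatrixMultiplication.MatrixMultiplication.Theorems.GroupTheoreticSTPPCThesisNoFour444Order127

/-!
# No `(4,4,4)×3 + (3,4,4)` STPP family in an abelian group of order `121` (T_E residual Q3.10)

Support file for route `MatrixMultiplication/GroupTheoreticSTPP`, crux `stmt-MatrixMultiplication-0597`, and for the
cell route `AbelianSTPPCensus` (crux `TEResidualSmall`, order `121`, all three rotation instances); cell `mm-stpp`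
(D-0046), CENSUS-PLAN §6.1 Q3.10; memo `HOME/mm-stpp-eng-2/TE-RESIDUALS.md` §3 (mm-stpp-eng-2, REF PASS g7).

The order-`127` argument of `GroupTheoreticSTPPCThesisNoFour444Order127.lean` with Cauchy–Davenport replaced by
**Kneser's theorem** (`Literature.Combinatorics.Additive.add_kneser`, landed by the lit seat): in a group of order
`121 = 11²` the stabiliser of a sumset has order `1`, `11` or `121`, which gives the growth `|Y| ≥ 31 ⇒ |Y − Y| ≥ 55 ⇒
|(Y−Y)+(Y−Y)| ≥ 99`, while the energy count caps the last set at `78` elements.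

* `no_isSTPP_444x3_344_order121` — shapes `A = (4,4,4,3)`, `B = C = (4,4,4,4)`;
* `no_isSTPP_444x3_443_order121`, `no_isSTPP_444x3_434_order121` — the two rotation instances, by `stpp_rotate`.

WHAT THIS IS NOT: no `ω` statement; one residual multiset (three rotation instances) of the abelian T_E census.
-/

-- single-conjunct summit: the mandated namespace repeats `MatrixMultiplication`.
set_option linter.dupNamespace false

namespace Summit.MatrixMultiplication.MatrixMultiplication.Theorems

namespace STPPEnergy

open Finset Literature.Computability.AlgebraicComplexity Literature.Combinatorics.Additive
open scoped Pointwise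

variable {H : Type*} [AddCommGroup H] [Fintype H] [DecidableEq H]

/-- The divisors of `121 = 11²`. [folklore] -/
theorem eq_of_dvd_121 {d : ℕ} (h : d ∣ 121) : d = 1 ∨ d = 11 ∨ d = 121 := by
  have hp : Nat.Prime 11 := by norm_num
  have h' : d ∣ 11 ^ 2 := by norm_num; exact h
  obtain ⟨i, hi, rfl⟩ := (Nat.dvd_prime_pow hp).1 h'
  interval_cases i <;> simp

/-- **Kneser growth in a group of order `121`.**  For non-empty `S, T` with `n ≤ |S|, |T|`, and a bound `b`
compatible with the three possible stabiliser orders `1, 11, 121` of `S + T` (`b ≤ 2n − 1`; `b + 11 ≤ 22u`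
whenever `n ≤ 11u`; `b ≤ 121`): `b ≤ |S + T|`.  (Kneser: `|S + K| + |T + K| ≤ |S + T| + |K|`, `K` the stabiliser,
`|K| ∣ 121`, `|K| ∣ |S + K|`.) [cite: Nathanson1996, Thm 4.3] -/
theorem kneser_121 (hH : Fintype.card H = 121) {S T : Finset H} (hS : S.Nonempty) (hT : T.Nonempty)
    {n b : ℕ} (hnS : n ≤ S.card) (hnT : n ≤ T.card) (hb1 : b ≤ 2 * n - 1)
    (hb2 : ∀ u : ℕ, n ≤ 11 * u → b + 11 ≤ 22 * u) (hb3 : b ≤ 121) : b ≤ (S + T).card := by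
  set K := (S + T).addStab with hK
  have hkn := add_kneser S T
  rw [← hK] at hkn
  have hdvd : K.card ∣ 121 := by rw [← hH]; exact (hS.add hT).card_addStab_dvd_card_univ
  have hdS : K.card ∣ (S + K).card := card_addStab_dvd_card_add_addStab S (S + T)
  have hdT : K.card ∣ (T + K).card := card_addStab_dvd_card_add_addStab T (S + T)
  have hKne : K.Nonempty := (hS.add hT).addStab
  have hSK : S.card ≤ (S + K).card := card_le_card_add_right hKne
  have hTK : T.card ≤ (T + K).card := card_le_card_add_right hKne
  have hSpos := hS.card_pos
  have hTpos := hT.card_pos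
  rcases eq_of_dvd_121 hdvd with h1 | h11 | h121
  · rw [h1] at hkn; omega
  · rw [h11] at hkn hdS hdT
    obtain ⟨u, hu⟩ := hdS
    obtain ⟨v, hv⟩ := hdT
    have h1 := hb2 u (by omega)
    have h2 := hb2 v (by omega)
    omega
  · rw [h121] at hkn hdS hdT
    obtain ⟨u, hu⟩ := hdS
    obtain ⟨v, hv⟩ := hdT
    have hu1 : 1 ≤ u := by
      rcases Nat.eq_zero_or_pos u with h0 | h0
      · rw [h0, mul_zero] at hu; omega
      · exact h0
    have hv1 : 1 ≤ v := by
      rcases Nat.eq_zero_or_pos v with h0 | h0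
      · rw [h0, mul_zero] at hv; omega
      · exact h0
    have : 121 ≤ 121 * u := by nlinarith
    have : 121 ≤ 121 * v := by nlinarith
    omega

/-- **No `IsSTPP` family with shapes `(4,4,4),(4,4,4),(4,4,4),(3,4,4)` in an abelian group of order `121`.**
[original] -/
theorem no_isSTPP_444x3_344_order121 (hH : Fintype.card H = 121) (A B C : Fin 4 → Finset H)
    (hA : ∀ i, (A i).card = ![4, 4, 4, 3] i) (hB : ∀ i, (B i).card = 4) (hC : ∀ i, (C i).card = 4) :
    ¬ IsSTPP A B C := by
  intro h
  have hAne : ∀ i, (A i).Nonempty := fun i => card_pos.1 (by rw [hA i]; fin_cases i <;> simp)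
  have hBne : ∀ i, (B i).Nonempty := fun i => card_pos.1 (by rw [hB i]; norm_num)
  have hCne : ∀ i, (C i).Nonempty := fun i => card_pos.1 (by rw [hC i]; norm_num)
  set D := univ.biUnion fun t => A t - B t with hDdef
  set E := univ.biUnion fun t => B t - C t with hEdef
  set F := univ.biUnion fun t => C t - A t with hFdef
  have hDc : D.card = 60 := by
    rw [hDdef, card_biUnion_sub h hCne]; simp [hA, hB, Fin.sum_univ_four]
  have hEc : E.card = 64 := by
    rw [hEdef, card_biUnion_sub (OmegaCensus.stpp_rotate h) hAne]; simp [hB, hC]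
  have hFc : F.card = 60 := by
    rw [hFdef, card_biUnion_sub (OmegaCensus.stpp_rotate (OmegaCensus.stpp_rotate h)) hBne]
    simp [hC, hA, Fin.sum_univ_four]
  set X := univ \ D.image Neg.neg with hXdef
  have hDimg : (D.image Neg.neg).card = 60 := by rw [card_image_of_injective _ neg_injective, hDc]
  have hXc : X.card = 61 := by
    rw [hXdef, card_sdiff_of_subset (subset_univ _), card_univ, hH, hDimg]
  set r : H → ℕ := fun x => (E.filter fun e => x - e ∈ F).card with hrdef
  have hsum : ∑ x ∈ X, r x = 3600 := by
    have := sum_rep_compl h hCne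
    simp only [hA, hB, hC, Fin.sum_univ_four] at this
    rw [← hDdef, ← hEdef, ← hFdef, hEc, hFc, ← hXdef] at this
    simp only [hrdef]
    simp at this
    omega
  have hle : ∀ x, r x ≤ 60 := fun x => (card_filter_rep_le E F x).trans hFc.le
  -- Y := points of X with r ≥ 59 ; |Y| ≥ 31
  set Y := X.filter fun x => 59 ≤ r x with hYdef
  have hYc : 31 ≤ Y.card := by
    have hsplit := sum_filter_add_sum_filter_not X (fun x => 59 ≤ r x) r
    have h1 : ∑ x ∈ Y, r x ≤ 60 * Y.card := by
      rw [mul_comm, ← smul_eq_mul, ← sum_const]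
      exact sum_le_sum fun x _ => hle x
    have h2 : ∑ x ∈ X.filter (fun x => ¬ 59 ≤ r x), r x ≤ 58 * (X.filter fun x => ¬ 59 ≤ r x).card := by
      rw [mul_comm, ← smul_eq_mul, ← sum_const]
      exact sum_le_sum fun x hx => by have := (mem_filter.1 hx).2; omega
    have h3 := card_filter_add_card_filter_not (s := X) (fun x => 59 ≤ r x)
    rw [hXc, ← hYdef] at h3
    rw [← hYdef, hsum] at hsplit
    omega
  have hYne : Y.Nonempty := card_pos.1 (by omega)
  -- g(t) := #{e ∈ E : e + t ∈ E}; on Y − Y it is ≥ 58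
  set g : H → ℕ := fun t => (E.filter fun e => e + t ∈ E).card with hgdef
  have hgS : ∀ d ∈ Y - Y, 58 ≤ g d := by
    intro d hd
    rw [mem_sub] at hd
    obtain ⟨y, hy, y', hy', rfl⟩ := hd
    have h1 := rep_add_rep_le E F y' y
    have hy1 := (mem_filter.1 hy).2; have hy2 := (mem_filter.1 hy').2
    simp only [hrdef] at hy1 hy2
    rw [hFc] at h1
    simp only [hgdef]
    omega
  -- Kneser: |Y − Y| ≥ 55
  have hSne : (Y - Y).Nonempty := hYne.sub hYne
  have hSc : 55 ≤ (Y - Y).card := by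
    have hk := kneser_121 hH hYne hYne.neg (n := 31) (b := 55) hYc (by rw [card_neg]; exact hYc)
      (by omega) (fun u hu => by omega) (by omega)
    rwa [← sub_eq_add_neg] at hk
  -- on (Y − Y) + (Y − Y) the count is ≥ 52; energy caps that set at 78 elements
  have hgT : ∀ d ∈ (Y - Y) + (Y - Y), 52 ≤ g d := by
    intro d hd
    rw [mem_add] at hd
    obtain ⟨d₁, hd₁, d₂, hd₂, rfl⟩ := hd
    have := card_filter_add_mem_superadd E d₁ d₂
    have h1 := hgS d₁ hd₁; have h2 := hgS d₂ hd₂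
    simp only [hgdef] at h1 h2 ⊢
    rw [hEc] at this
    omega
  have htot : ∑ t, g t = 4096 := by
    simp only [hgdef]; rw [sum_card_filter_add_mem, hEc]
  have hT : 52 * ((Y - Y) + (Y - Y)).card ≤ ∑ t ∈ (Y - Y) + (Y - Y), g t := by
    rw [mul_comm, ← smul_eq_mul, ← sum_const]
    exact sum_le_sum hgT
  have hsub : ∑ t ∈ (Y - Y) + (Y - Y), g t ≤ ∑ t, g t :=
    sum_le_sum_of_subset_of_nonneg (subset_univ _) fun _ _ _ => Nat.zero_le _
  have hTc : ((Y - Y) + (Y - Y)).card ≤ 78 := by omega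
  -- Kneser again: |(Y−Y)+(Y−Y)| ≥ 99
  have hk := kneser_121 hH hSne hSne (n := 55) (b := 99) hSc hSc (by omega) (fun u hu => by omega) (by omega)
  omega

/-- Rotation instance `(4,4,4),(4,4,4),(4,4,4),(4,3,4)` (the `3`-set in the `B`-position). [original] -/
theorem no_isSTPP_444x3_434_order121 (hH : Fintype.card H = 121) (A B C : Fin 4 → Finset H)
    (hA : ∀ i, (A i).card = 4) (hB : ∀ i, (B i).card = ![4, 4, 4, 3] i) (hC : ∀ i, (C i).card = 4) :
    ¬ IsSTPP A B C := fun h =>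
  no_isSTPP_444x3_344_order121 hH B C A hB hC hA (OmegaCensus.stpp_rotate h)

/-- Rotation instance `(4,4,4),(4,4,4),(4,4,4),(4,4,3)` (the `3`-set in the `C`-position). [original] -/
theorem no_isSTPP_444x3_443_order121 (hH : Fintype.card H = 121) (A B C : Fin 4 → Finset H)
    (hA : ∀ i, (A i).card = 4) (hB : ∀ i, (B i).card = 4) (hC : ∀ i, (C i).card = ![4, 4, 4, 3] i) :
    ¬ IsSTPP A B C := fun h =>
  no_isSTPP_444x3_344_order121 hH C A B hC hA hB (OmegaCensus.stpp_rotate (OmegaCensus.stpp_rotate h))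

end STPPEnergy

end Summit.MatrixMultiplication.MatrixMultiplication.Theorems
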